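import Mathlib
import Summits.CriticalPhenomena.CardyFormulaZ2.Theorems.CardySelfRefinementDefs
import Summits.CriticalPhenomena.CardyFormulaZ2.Theorems.CardySelfRefinementGradientComparabilityStubDrhoEqSignedSum
import Literature.Probability.Percolation.SelfRefinementMeasure
import HarnessLib

/-!
# Crux `GradientComparability` (stmt-CriticalPhenomena-10269), line `monotone-product-coordinates` —
# support for stub `stub_cornerPatch`: the corner patch from the two slice windows, and the
# one-sided `ρ`-derivative on the slice `ρ = 1` as an untie-influence sum

Route `CardySelfRefinement`, sub-problem `CriticalPhenomena/CardyFormulaZ2`; vocabulary from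
`CardySelfRefinementDefs` (`prm`, `cfg`, `Aloc`, `coinWindow`, `window`, `P`, `Dρ`).

The registered stub `stub_cornerPatch` (Kesten window at the independent corner `(ρ, c) = (1, 0)`)
asks that `|∂ρP|` be comparable, up to one mesh-uniform constant, between any two points of the
level band `{P_η ∈ [vlo, vhi]}` lying on the two parameter slices through the corner,
`{c = 0}` (coarse Bernoulli bond percolation on `kℤ²` with parameter `ρ/2 + (1-ρ)2^{-k}`, critical
at `ρ = 1`) and `{ρ = 1}` (tied bundles plus independent Bernoulli(`c`) cell interiors).  This
file records two honest pieces of that statement.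

* `Drho_one_eq_sum_untie` — **dictionary on the slice `ρ = 1`**: there every selector coin is
  almost surely ON (`prm k 1 c` gives the selectors bias `projIcc 0 1 1 = 1`), so in the signed
  Russo sum `stub_Drho_eq_signed_sum` the term "selector forced on" is `P` itself and the
  ONE-SIDED derivative `Dρ k m F η (1, c)` (a `derivWithin` on `[0,1]` at the right endpoint) is
  `Σ_bundles (P − P(E after untying the bundle))`, i.e. minus the sum of the untie influences.
* `stub_cornerPatch_of_sliceWindows` — **the corner patch from the two slice windows**: if on
  each slice separately every band point `q` has `|∂ρP(q)|` comparable to the corner value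
  `|∂ρP(1, 0)|` (hypothesis `h0`: the slice `c = 0`, Kesten's near-critical stability of the
  pivotal count for Bernoulli percolation on `kℤ²` in `M_k` clothing — the tree's unproved named
  facts `Kesten1987_zdFourArmStability`, `Kesten1987_zdPivotalCount_sameParam` are its square /
  homogeneous core; hypothesis `h1`: the slice `ρ = 1`, the same stability for the enhancement of
  critical coarse percolation by Bernoulli(`c`) cell interiors — a three-parameter Kesten window,
  not in the tree), then the registered signature of `stub_cornerPatch` holds with `Λ = C²`.
  Pure bookkeeping (`max` of the constants, `min` of the mesh thresholds); no percolation input.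
-/

noncomputable section

namespace Summit.CriticalPhenomena.CardyFormulaZ2.Theorems.CardySelfRefinement

open scoped Topology
open Filter Set MeasureTheory
open Literature.Probability.LatticeModels Literature.Probability.Percolation
open Literature.Probability.Percolation.QuadCrossing
open Summit.CriticalPhenomena.CardyFormulaZ2.Theses.CardySelfRefinement

/-! ## The slice `ρ = 1`: selectors are almost surely on -/

/-- At `ρ = 1` a selector coin (`i.2.2 = 2`, bias `projIcc 0 1 1 = 1`) is almost surely on. -/
theorem ae_selector_mem_of_rho_one (k : ℕ) (c : ℝ) {i : Site 2 × Fin 2 × Fin 3} (hi : i.2.2 = 2) :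
    ∀ᵐ S ∂prodBernoulli (prm k 1 c), i ∈ S := by
  refine prodBernoulli_ae_mem _ ?_
  have h2 : ¬ (i.2.2 = 0) := by rw [hi]; decide
  have h1 : ¬ (i.2.2 = 1) := by rw [hi]; decide
  simp only [prm, h2, if_false, h1]
  exact projIcc_unitInterval_one

/-- At `ρ = 1`, forcing a selector coin ON is invisible to the coin law: for every event `E`,
`P₁{S | insert i S ∈ E} = P₁(E)`. -/
theorem real_setOf_insert_mem_of_rho_one (k : ℕ) (c : ℝ) {i : Site 2 × Fin 2 × Fin 3}
    (hi : i.2.2 = 2) (E : Set (Set (Site 2 × Fin 2 × Fin 3))) :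
    (prodBernoulli (prm k 1 c)).real {S | insert i S ∈ E} = (prodBernoulli (prm k 1 c)).real E := by
  apply measureReal_congr
  filter_upwards [ae_selector_mem_of_rho_one k c hi] with S hS
  show (insert i S ∈ E) = (S ∈ E)
  rw [Set.insert_eq_of_mem hS]

/-- **Dictionary on the slice `ρ = 1` (one-sided derivative as an untie-influence sum).**  For
`η ≠ 0`, any `c`, and the coin Finset `K` of the window, the one-sided `ρ`-derivative at the edge
`ρ = 1` is `Dρ k m F η (1, c) = Σ_{i ∈ K, i selector} (P k m F η 1 c − P₁{S | S ∖ {i} ∈ E})`,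
`E = cfg k ⁻¹' Aloc m F η`, `P₁ = prodBernoulli (prm k 1 c)`: minus the sum over the bundles of the
window of the influence of UNTYING the bundle (all other bundles tied, interiors Bernoulli(`c`)). -/
theorem Drho_one_eq_sum_untie (k m : ℕ) (F : Fin m → Quad (Set.univ : Set ℂ)) {η : ℝ} (hη : η ≠ 0)
    (c : ℝ) (K : Finset (Site 2 × Fin 2 × Fin 3))
    (hK : (↑K : Set (Site 2 × Fin 2 × Fin 3)) = coinWindow k (window m F η)) :
    Dρ k m F η (1, c) = ∑ i ∈ K with i.2.2 = 2,
      (P k m F η 1 c - (prodBernoulli (prm k 1 c)).real {S | S \ {i} ∈ (cfg k) ⁻¹' Aloc m F η}) := by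
  rw [stub_Drho_eq_signed_sum k m F hη ⟨zero_le_one, le_rfl⟩ c K hK]
  refine Finset.sum_congr rfl fun i hi => ?_
  rw [Finset.mem_filter] at hi
  rw [real_setOf_insert_mem_of_rho_one k c hi.2, ← P_eq_real_preimage_Aloc k m F hη 1 c]

/-! ## The corner patch from the two slice windows -/

/-- **The corner patch from the two slice windows** (support for the registered stub
`stub_cornerPatch`).  Hypothesis `h0` (slice `c = 0`): every band point `(ρ, 0)` has `|∂ρP|`
comparable to the corner value `|∂ρP(1,0)|`, mesh-uniformly; hypothesis `h1` (slice `ρ = 1`): the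
same for the band points `(1, c)`.  Conclusion: the registered signature of `stub_cornerPatch`
(comparability between any two band points of `{ρ = 1} ∪ {c = 0}`), with `Λ = C²` for the common
constant `C = max (max C₀ C₁) 0` and the mesh threshold `min η₀ η₁`. -/
theorem stub_cornerPatch_of_sliceWindows
    (h0 : ∀ k : ℕ, k = 2 ∨ k = 3 → ∀ (m : ℕ) (F : Fin m → Quad (Set.univ : Set ℂ)), 0 < m →
      ∀ vlo vhi : ℝ, 0 < vlo → vlo < vhi → vhi < 1 →
        ∃ C η₁ : ℝ, 0 < η₁ ∧ ∀ η ∈ Set.Ioo 0 η₁, ∀ ρ ∈ Set.Icc (0 : ℝ) 1,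
          P k m F η ρ 0 ∈ Set.Icc vlo vhi →
            |Dρ k m F η (ρ, 0)| ≤ C * |Dρ k m F η (1, 0)| ∧
              |Dρ k m F η (1, 0)| ≤ C * |Dρ k m F η (ρ, 0)|)
    (h1 : ∀ k : ℕ, k = 2 ∨ k = 3 → ∀ (m : ℕ) (F : Fin m → Quad (Set.univ : Set ℂ)), 0 < m →
      ∀ vlo vhi : ℝ, 0 < vlo → vlo < vhi → vhi < 1 →
        ∃ C η₁ : ℝ, 0 < η₁ ∧ ∀ η ∈ Set.Ioo 0 η₁, ∀ c ∈ Set.Icc (0 : ℝ) 1,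
          P k m F η 1 c ∈ Set.Icc vlo vhi →
            |Dρ k m F η (1, c)| ≤ C * |Dρ k m F η (1, 0)| ∧
              |Dρ k m F η (1, 0)| ≤ C * |Dρ k m F η (1, c)|) :
    ∀ k : ℕ, k = 2 ∨ k = 3 → ∀ (m : ℕ) (F : Fin m → Quad (Set.univ : Set ℂ)), 0 < m →
      ∀ vlo vhi : ℝ, 0 < vlo → vlo < vhi → vhi < 1 →
        ∃ Λ η₁ : ℝ, 0 < η₁ ∧ ∀ η ∈ Set.Ioo 0 η₁,
          ∀ q ∈ Set.Icc (0 : ℝ) 1 ×ˢ Set.Icc (0 : ℝ) 1, ∀ q' ∈ Set.Icc (0 : ℝ) 1 ×ˢ Set.Icc (0 : ℝ) 1,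
            (q.1 = 1 ∨ q.2 = 0) → (q'.1 = 1 ∨ q'.2 = 0) →
              P k m F η q.1 q.2 ∈ Set.Icc vlo vhi → P k m F η q'.1 q'.2 ∈ Set.Icc vlo vhi →
                |Dρ k m F η q| ≤ Λ * |Dρ k m F η q'| := by
  intro k hk m F hm vlo vhi hvlo hvv hvhi
  obtain ⟨C₀, η₀, hη₀, H0⟩ := h0 k hk m F hm vlo vhi hvlo hvv hvhi
  obtain ⟨C₁, η₁, hη₁, H1⟩ := h1 k hk m F hm vlo vhi hvlo hvv hvhi
  set C : ℝ := max (max C₀ C₁) 0 with hC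
  have hC0 : C₀ ≤ C := (le_max_left _ _).trans (le_max_left _ _)
  have hC1 : C₁ ≤ C := (le_max_right _ _).trans (le_max_left _ _)
  have hCnn : 0 ≤ C := le_max_right _ _
  -- every band point of the two slices is pinned to the corner with the common constant `C`
  have pin : ∀ η ∈ Set.Ioo 0 (min η₀ η₁), ∀ q ∈ Set.Icc (0 : ℝ) 1 ×ˢ Set.Icc (0 : ℝ) 1,
      (q.1 = 1 ∨ q.2 = 0) → P k m F η q.1 q.2 ∈ Set.Icc vlo vhi →
        |Dρ k m F η q| ≤ C * |Dρ k m F η (1, 0)| ∧ |Dρ k m F η (1, 0)| ≤ C * |Dρ k m F η q| := by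
    rintro η ⟨hηpos, hηlt⟩ ⟨ρ, c⟩ ⟨hρ, hc⟩ hslice hband
    rcases hslice with h | h
    · obtain rfl : ρ = 1 := h
      obtain ⟨ha, hb⟩ := H1 η ⟨hηpos, hηlt.trans_le (min_le_right _ _)⟩ c hc hband
      exact ⟨ha.trans (mul_le_mul_of_nonneg_right hC1 (abs_nonneg _)),
        hb.trans (mul_le_mul_of_nonneg_right hC1 (abs_nonneg _))⟩
    · obtain rfl : c = 0 := h
      obtain ⟨ha, hb⟩ := H0 η ⟨hηpos, hηlt.trans_le (min_le_left _ _)⟩ ρ hρ hband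
      exact ⟨ha.trans (mul_le_mul_of_nonneg_right hC0 (abs_nonneg _)),
        hb.trans (mul_le_mul_of_nonneg_right hC0 (abs_nonneg _))⟩
  refine ⟨C * C, min η₀ η₁, lt_min hη₀ hη₁, fun η hη q hq q' hq' hs hs' hb hb' => ?_⟩
  obtain ⟨hq1, -⟩ := pin η hη q hq hs hb
  obtain ⟨-, hq'2⟩ := pin η hη q' hq' hs' hb'
  calc |Dρ k m F η q| ≤ C * |Dρ k m F η (1, 0)| := hq1
    _ ≤ C * (C * |Dρ k m F η q'|) := mul_le_mul_of_nonneg_left hq'2 hCnn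
    _ = C * C * |Dρ k m F η q'| := by ring

end Summit.CriticalPhenomena.CardyFormulaZ2.Theorems.CardySelfRefinement

end
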